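import Summits.QuantumFields.BalabanUV.Beta.GAN24.CovariantCurveTaylor

/-!
# `BalabanUV.Beta.GAN24.ExponentialChartJets` — binder row G-an2-4 ∕ (CONV-C), route R7 «TWO CURRENCIES», PART 245: THE EXPONENTIAL CHART `U_s = exp(isηA)` OF A REAL CONNECTION —
# ITS CONNECTION AND ZEROTH-ORDER FIELD ALONG THE CURVE AND ALL THEIR JETS AT `s = 0`, IN CLOSED FORM.  With `θ = iA∕n` (`n = η⁻¹ = L^k`): `−w_s = n − n·e^{sθ}` (jets at `0`: `0`, then `−nθ^j = −(iA)^j∕n^{j−1}`), and — the point of the exponential chart — the zeroth-order field is UNSHIFTED and even in `s`: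
# `z_s(x) = −n²Σ_ν(e^{sθ_ν(x)} + e^{−sθ_ν(x)} − 2) = Σ_ν 2n²(1 − cos(sA_ν(x)∕n)) = Σ_ν|w_{s,ν}(x)|²` (the shifted terms of NE2's `zfield` CANCEL because `e^{sθ}e^{−sθ} = 1`, i.e. `|U_s| = 1`),
# jets at `0`: `0` for `j = 0` and odd `j`, `−n²Σ_ν(θ_ν^j + (−θ_ν)^j)` in general (`j = 2`: `2Σ_νA_ν(x)²`).  PART 246 feeds these jets to PART 242 (unit b2b-balaban-gan24-p3, gen 65; v1)

NOT IN PRINT; OUR PROOF ([folklore] one-variable calculus BY NAME: Mathlib's `HasDerivAt.cexp`, `HasDerivAt.ofReal_comp`, `iteratedDeriv_succ ∕ _succ' ∕ _zero`, `Complex.exp_conj`, `Complex.exp_add`,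
`Complex.contDiff_exp`; NE2's `AbelianCovariantLaplacian` (`connV`, `zT`, `conn`, `zfield`, `negConn`, `tauInv`); [Balaban1985BackgroundPropagators] (3.3) p. 390, (3.35) p. 396 LOCATE the shapes
(`U = e^{iηA}`); nothing printed is a hypothesis).
HONEST FRAMING (cell contract, verbatim): «discharging `BetaPertH` makes Bałaban's UV stability UNCONDITIONAL — a real constructive-QFT result; it is NOT the
continuum limit and NOT the Clay problem.»  HONEST DEPENDENCY (verbatim): «continuum YM on T⁴ ⇐ BetaPertH ∧ nine spine estimates (0/9 proved); BetaPertH ⇐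
(D1) ∧ (D4) ∧ CAP+tail; G-an2-4 gates asym, D1 and NE2/3/4.»

WHAT THIS FILE PROVES (0 sorry, 0 `def`; `U^A_s k ν x = exp((I·A k ν x ∕ n_k)·s)`, `A` REAL, `θ = I·A∕n_k`):
* §1 (scalar) `hasDerivAt_const_mul_cexp`, `hasDerivAt_cexp_mul_ofReal`, **`iteratedDeriv_const_mul_cexp`** (`∂^j_s[c·e^{θs}] = cθ^j e^{θs}`), `iteratedDeriv_two_cexp`,
  `iteratedDeriv_sum_two_cexp` (finite sums of pairs of exponentials), `deriv_const_sub_const_mul_cexp`, `hasDerivAt_zEntry`, `contDiff_expChart_entry`.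
* §2 **`connV_expChart`** (`−w_s = n − n·e^{θs}`), `conj_theta`, `star_conn_expChart` (`(n(e^{θs} − 1))* = n(e^{−θs} − 1)`), `cexp_neg_mul_cexp`, **`zT_expChart`** (`z_s = −n²Σ_ν(e^{θs} + e^{−θs} − 2)`,
  UNSHIFTED).
* §3 **`iteratedDeriv_connV_expChart`** (`∂^j_s(−w)|₀ = [j ≥ 1]·(−nθ^j)`), **`iteratedDeriv_zT_expChart`** (`∂^j_s z|₀ = [j ≥ 1]·(−n²Σ_ν(θ_ν^j + (−θ_ν)^j))`).
WHAT IT DOES NOT DO: the background properties of these jets and the END (PART 246).  SUPPLIER work; NEVER «G-an2-4 closed»; NOT (CONV-C), NOT D1, NOT `BetaPertH`, NOT continuum, NOT Clay.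
Records: `HOME/b2b-balaban-gan24-p3/gen65/README.md`.
-/

noncomputable section

open scoped BigOperators ComplexConjugate Matrix Matrix.Norms.L2Operator
open Filter Topology

namespace Summit.QuantumFields.BalabanUV.Beta.GAN24.ExponentialChartJets

open Literature.MathematicalPhysics.QuantumFieldTheory.Balaban1983to89
open Literature.MathematicalPhysics.QuantumFieldTheory.Balaban1983to89.B5Prop11Plancherel (Tor fine)
open Literature.MathematicalPhysics.QuantumFieldTheory.Balaban1983to89.B5G183RateUnitTower (lev)
open Summit.QuantumFields.BalabanUV.T4Continuum
open Summit.QuantumFields.BalabanUV.T4Continuum.BalabanAveragedTowerUnit (idx)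
open Summit.QuantumFields.BalabanUV.T4Continuum.AbelianCovariantLaplacian (connV zT conn zfield negConn tauInv)

/-! ## §1 Scalar calculus of `s ↦ c·e^{θs}` over a real parameter -/

section Scalar

/-- `∂_s[c·e^{θs}] = cθ·e^{θs}` (real parameter, complex values). [folklore] -/
theorem hasDerivAt_const_mul_cexp (c θ : ℂ) (s : ℝ) :
    HasDerivAt (fun v : ℝ => c * Complex.exp (θ * (v : ℂ))) (c * θ * Complex.exp (θ * (s : ℂ))) s := by
  have hθ : HasDerivAt (fun v : ℝ => θ * (v : ℂ)) θ s := by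
    simpa using ((hasDerivAt_id s).ofReal_comp).const_mul θ
  have h := (hθ.cexp).const_mul c
  refine h.congr_deriv ?_
  ring

/-- `∂_s[e^{θs}] = θ·e^{θs}`. [folklore] -/
theorem hasDerivAt_cexp_mul_ofReal (θ : ℂ) (s : ℝ) : HasDerivAt (fun v : ℝ => Complex.exp (θ * (v : ℂ))) (θ * Complex.exp (θ * (s : ℂ))) s := by
  have h := hasDerivAt_const_mul_cexp 1 θ s
  simp only [one_mul] at h
  exact h

/-- **`∂^j_s[c·e^{θs}] = cθ^j·e^{θs}`**. [folklore] -/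
theorem iteratedDeriv_const_mul_cexp (c θ : ℂ) (j : ℕ) :
    iteratedDeriv j (fun v : ℝ => c * Complex.exp (θ * (v : ℂ))) = fun v : ℝ => c * θ ^ j * Complex.exp (θ * (v : ℂ)) := by
  induction j with
  | zero => funext v; simp [iteratedDeriv_zero]
  | succ j ih =>
    rw [iteratedDeriv_succ, ih]
    funext v
    rw [(hasDerivAt_const_mul_cexp (c * θ ^ j) θ v).deriv]
    ring

/-- `∂^j_s[a·e^{θs} + b·e^{θ′s}] = aθ^j e^{θs} + bθ′^j e^{θ′s}`. [folklore] -/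
theorem iteratedDeriv_two_cexp (a b θ θ' : ℂ) (j : ℕ) :
    iteratedDeriv j (fun v : ℝ => a * Complex.exp (θ * (v : ℂ)) + b * Complex.exp (θ' * (v : ℂ)))
      = fun v : ℝ => a * θ ^ j * Complex.exp (θ * (v : ℂ)) + b * θ' ^ j * Complex.exp (θ' * (v : ℂ)) := by
  induction j with
  | zero => funext v; simp [iteratedDeriv_zero]
  | succ j ih =>
    rw [iteratedDeriv_succ, ih]
    funext v
    rw [((hasDerivAt_const_mul_cexp (a * θ ^ j) θ v).fun_add (hasDerivAt_const_mul_cexp (b * θ' ^ j) θ' v)).deriv]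
    ring

/-- `∂^j_s Σ_i [a_i·e^{θ_i s} + b_i·e^{θ′_i s}] = Σ_i [a_iθ_i^j e^{θ_i s} + b_iθ′_i^j e^{θ′_i s}]` (finite sums; induction with `HasDerivAt.fun_sum`). [folklore] -/
theorem iteratedDeriv_sum_two_cexp {ι : Type*} (u : Finset ι) (a b θ θ' : ι → ℂ) (j : ℕ) :
    iteratedDeriv j (fun v : ℝ => ∑ i ∈ u, (a i * Complex.exp (θ i * (v : ℂ)) + b i * Complex.exp (θ' i * (v : ℂ))))
      = fun v : ℝ => ∑ i ∈ u, (a i * θ i ^ j * Complex.exp (θ i * (v : ℂ)) + b i * θ' i ^ j * Complex.exp (θ' i * (v : ℂ))) := by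
  induction j with
  | zero => funext v; simp [iteratedDeriv_zero]
  | succ j ih =>
    rw [iteratedDeriv_succ, ih]
    funext v
    have h : HasDerivAt (fun v : ℝ => ∑ i ∈ u, (a i * θ i ^ j * Complex.exp (θ i * (v : ℂ)) + b i * θ' i ^ j * Complex.exp (θ' i * (v : ℂ))))
        (∑ i ∈ u, (a i * θ i ^ j * θ i * Complex.exp (θ i * (v : ℂ)) + b i * θ' i ^ j * θ' i * Complex.exp (θ' i * (v : ℂ)))) v :=
      HasDerivAt.fun_sum fun i _ => (hasDerivAt_const_mul_cexp (a i * θ i ^ j) (θ i) v).fun_add (hasDerivAt_const_mul_cexp (b i * θ' i ^ j) (θ' i) v)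
    rw [h.deriv]
    refine Finset.sum_congr rfl fun i _ => ?_
    ring

/-- `∂_s[c₀ − c·e^{θs}] = −cθ·e^{θs}`. [folklore] -/
theorem deriv_const_sub_const_mul_cexp (c₀ c θ : ℂ) :
    deriv (fun v : ℝ => c₀ - c * Complex.exp (θ * (v : ℂ))) = fun v : ℝ => -(c * θ) * Complex.exp (θ * (v : ℂ)) := by
  funext v
  rw [((hasDerivAt_const_mul_cexp c θ v).const_sub c₀).deriv]
  ring

/-- `∂_s[−c²(e^{θs} + e^{−θs} − 2)] = (−c²θ)e^{θs} + (c²θ)e^{−θs}`. [folklore] -/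
theorem hasDerivAt_zEntry (c θ : ℂ) (v : ℝ) :
    HasDerivAt (fun v : ℝ => -c ^ 2 * (Complex.exp (θ * (v : ℂ)) + Complex.exp (-θ * (v : ℂ)) - 2))
      (-c ^ 2 * (θ * Complex.exp (θ * (v : ℂ)) + -θ * Complex.exp (-θ * (v : ℂ)))) v :=
  (((hasDerivAt_cexp_mul_ofReal θ v).fun_add (hasDerivAt_cexp_mul_ofReal (-θ) v)).sub_const (2 : ℂ)).const_mul (-c ^ 2)

/-- the entries of the exponential chart are `C^∞` in `s`. [folklore] -/
theorem contDiff_expChart_entry (θ : ℂ) (n : ℕ) : ContDiff ℝ n (fun v : ℝ => Complex.exp (θ * (v : ℂ))) :=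
  Complex.contDiff_exp.comp (contDiff_const.mul Complex.ofRealCLM.contDiff)

end Scalar

/-! ## §2 The exponential chart: connection and zeroth-order field -/

section Chart

variable {d : ℕ} (L : ℕ) [NeZero L] (M : Fin d → ℕ) [hM : ∀ μ, NeZero (M μ)]

omit [NeZero L] hM in
/-- **`connV_expChart`**: `−w_s = n − n·e^{θs}`, `θ = I·A∕n`, at every level. [folklore] -/
theorem connV_expChart (A : (k : ℕ) → Fin d → (idx L M k → ℝ)) (s : ℝ) :
    connV L M (fun k ν x => Complex.exp ((Complex.I * (A k ν x : ℂ) / ((lev L k : ℕ) : ℂ)) * (s : ℂ)))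
      = fun k ν x => ((lev L k : ℕ) : ℂ) - ((lev L k : ℕ) : ℂ) * Complex.exp ((Complex.I * (A k ν x : ℂ) / ((lev L k : ℕ) : ℂ)) * (s : ℂ)) := by
  funext k ν x
  simp only [connV, negConn, conn]
  ring

omit [NeZero L] in
/-- `conj θ = −θ` for `θ = I·a∕n` with `a, n` real. [folklore] -/
theorem conj_theta (a : ℝ) (n : ℕ) : conj (Complex.I * (a : ℂ) / ((n : ℕ) : ℂ)) = -(Complex.I * (a : ℂ) / ((n : ℕ) : ℂ)) := by
  rw [map_div₀, map_mul, Complex.conj_I, Complex.conj_ofReal, map_natCast]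
  ring

omit [NeZero L] in
/-- `(n(e^{θs} − 1))* = n(e^{−θs} − 1)` for `θ = I·a∕n`, real `s`. [folklore] -/
theorem star_conn_expChart (a : ℝ) (n : ℕ) (s : ℝ) :
    star (((n : ℕ) : ℂ) * (Complex.exp ((Complex.I * (a : ℂ) / ((n : ℕ) : ℂ)) * (s : ℂ)) - 1))
      = ((n : ℕ) : ℂ) * (Complex.exp (-(Complex.I * (a : ℂ) / ((n : ℕ) : ℂ)) * (s : ℂ)) - 1) := by
  rw [Complex.star_def, map_mul, map_natCast, map_sub, map_one, ← Complex.exp_conj, map_mul, conj_theta, Complex.conj_ofReal]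

omit [NeZero L] in
/-- `e^{−θs}·e^{θs} = 1`. [folklore] -/
theorem cexp_neg_mul_cexp (θ z : ℂ) : Complex.exp (-θ * z) * Complex.exp (θ * z) = 1 := by
  rw [← Complex.exp_add]
  simp

omit [NeZero L] hM in
/-- **`zT_expChart`**: for a REAL connection the zeroth-order field along the exponential chart is UNSHIFTED and even: `z_s(x) = −n²·Σ_ν (e^{θ_ν(x)s} + e^{−θ_ν(x)s} − 2)` (the `τ_ν⁻¹`-terms of
NE2's `zfield` cancel by `e^{−θs}e^{θs} = 1`). [folklore] -/
theorem zT_expChart (A : (k : ℕ) → Fin d → (idx L M k → ℝ)) (s : ℝ) :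
    zT L M (fun k ν x => Complex.exp ((Complex.I * (A k ν x : ℂ) / ((lev L k : ℕ) : ℂ)) * (s : ℂ)))
      = fun k x => -((lev L k : ℕ) : ℂ) ^ 2 * ∑ ν, (Complex.exp ((Complex.I * (A k ν x : ℂ) / ((lev L k : ℕ) : ℂ)) * (s : ℂ))
          + Complex.exp (-(Complex.I * (A k ν x : ℂ) / ((lev L k : ℕ) : ℂ)) * (s : ℂ)) - 2) := by
  funext k x
  simp only [zT, zfield, conn]
  rw [Finset.mul_sum]
  refine Finset.sum_congr rfl fun ν _ => ?_
  rw [star_conn_expChart, star_conn_expChart]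
  linear_combination (((lev L k : ℕ) : ℂ) ^ 2) * cexp_neg_mul_cexp (Complex.I * (A k ν (tauInv (fine (lev L k) M) ν x) : ℂ) / ((lev L k : ℕ) : ℂ)) (s : ℂ)

end Chart

/-! ## §3 The jets at `s = 0` -/

section Jets

variable {d : ℕ} (L : ℕ) [NeZero L] (M : Fin d → ℕ) [hM : ∀ μ, NeZero (M μ)]

omit [NeZero L] hM in
/-- **`iteratedDeriv_connV_expChart`**: `∂^j_s(−w_s)^{(k)}_ν(x)|₀ = [j ≥ 1]·(−n_kθ^j)`, `θ = I·A^{(k)}_ν(x)∕n_k`. [folklore] -/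
theorem iteratedDeriv_connV_expChart (A : (k : ℕ) → Fin d → (idx L M k → ℝ)) (j k : ℕ) (ν : Fin d) (x : idx L M k) :
    iteratedDeriv j (fun s : ℝ => connV L M (fun k' ν' x' => Complex.exp ((Complex.I * (A k' ν' x' : ℂ) / ((lev L k' : ℕ) : ℂ)) * (s : ℂ))) k ν x) 0
      = if j = 0 then 0 else -(((lev L k : ℕ) : ℂ) * (Complex.I * (A k ν x : ℂ) / ((lev L k : ℕ) : ℂ)) ^ j) := by
  simp only [connV_expChart]
  rcases j with _ | j
  · simp [iteratedDeriv_zero]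
  · rw [iteratedDeriv_succ', deriv_const_sub_const_mul_cexp, iteratedDeriv_const_mul_cexp]
    simp only [Nat.succ_ne_zero, if_false, Complex.ofReal_zero, mul_zero, Complex.exp_zero, mul_one]
    ring

omit [NeZero L] hM in
/-- **`iteratedDeriv_zT_expChart`**: `∂^j_s z^{(k)}_s(x)|₀ = [j ≥ 1]·(−n_k²·Σ_ν (θ_ν^j + (−θ_ν)^j))`. [folklore] -/
theorem iteratedDeriv_zT_expChart (A : (k : ℕ) → Fin d → (idx L M k → ℝ)) (j k : ℕ) (x : idx L M k) :
    iteratedDeriv j (fun s : ℝ => zT L M (fun k' ν' x' => Complex.exp ((Complex.I * (A k' ν' x' : ℂ) / ((lev L k' : ℕ) : ℂ)) * (s : ℂ))) k x) 0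
      = if j = 0 then 0 else -((lev L k : ℕ) : ℂ) ^ 2 * ∑ ν, ((Complex.I * (A k ν x : ℂ) / ((lev L k : ℕ) : ℂ)) ^ j + (-(Complex.I * (A k ν x : ℂ) / ((lev L k : ℕ) : ℂ))) ^ j) := by
  simp only [zT_expChart]
  rcases j with _ | j
  · simp only [iteratedDeriv_zero, Complex.ofReal_zero, mul_zero, Complex.exp_zero, if_true]
    norm_num
  · -- strip one derivative (the constant `−2` drops), then the two-exponential sum formula
    rw [iteratedDeriv_succ']
    have hd : deriv (fun s : ℝ => -((lev L k : ℕ) : ℂ) ^ 2 * ∑ ν, (Complex.exp ((Complex.I * (A k ν x : ℂ) / ((lev L k : ℕ) : ℂ)) * (s : ℂ))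
          + Complex.exp (-(Complex.I * (A k ν x : ℂ) / ((lev L k : ℕ) : ℂ)) * (s : ℂ)) - 2))
        = fun s : ℝ => ∑ ν, ((-((lev L k : ℕ) : ℂ) ^ 2 * (Complex.I * (A k ν x : ℂ) / ((lev L k : ℕ) : ℂ))) * Complex.exp ((Complex.I * (A k ν x : ℂ) / ((lev L k : ℕ) : ℂ)) * (s : ℂ))
          + (((lev L k : ℕ) : ℂ) ^ 2 * (Complex.I * (A k ν x : ℂ) / ((lev L k : ℕ) : ℂ))) * Complex.exp (-(Complex.I * (A k ν x : ℂ) / ((lev L k : ℕ) : ℂ)) * (s : ℂ))) := by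
      funext s
      have h : HasDerivAt (fun s : ℝ => -((lev L k : ℕ) : ℂ) ^ 2 * ∑ ν, (Complex.exp ((Complex.I * (A k ν x : ℂ) / ((lev L k : ℕ) : ℂ)) * (s : ℂ))
            + Complex.exp (-(Complex.I * (A k ν x : ℂ) / ((lev L k : ℕ) : ℂ)) * (s : ℂ)) - 2))
          (-((lev L k : ℕ) : ℂ) ^ 2 * ∑ ν, ((Complex.I * (A k ν x : ℂ) / ((lev L k : ℕ) : ℂ)) * Complex.exp ((Complex.I * (A k ν x : ℂ) / ((lev L k : ℕ) : ℂ)) * (s : ℂ))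
            + -(Complex.I * (A k ν x : ℂ) / ((lev L k : ℕ) : ℂ)) * Complex.exp (-(Complex.I * (A k ν x : ℂ) / ((lev L k : ℕ) : ℂ)) * (s : ℂ)))) s :=
        (HasDerivAt.fun_sum fun ν _ => ((hasDerivAt_cexp_mul_ofReal _ s).fun_add (hasDerivAt_cexp_mul_ofReal _ s)).sub_const (2 : ℂ)).const_mul _
      rw [h.deriv, Finset.mul_sum]
      refine Finset.sum_congr rfl fun ν _ => ?_
      ring
    rw [hd, iteratedDeriv_sum_two_cexp]
    simp only [Nat.succ_ne_zero, if_false, Complex.ofReal_zero, mul_zero, Complex.exp_zero, mul_one, Finset.mul_sum]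
    refine Finset.sum_congr rfl fun ν _ => ?_
    ring

end Jets

end Summit.QuantumFields.BalabanUV.Beta.GAN24.ExponentialChartJets

end
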